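import Summits.QuantumFields.QCD.Theses.NestedDissectionSea
import Literature.MathematicalPhysics.QuantumFieldTheory.QCD
import Summits.QuantumFields.QCD.Theorems.NestedDissectionSeaCoerciveSeaCensusDominates
import Summits.QuantumFields.QCD.Theorems.NestedDissectionSeaEarlyCrosserLawPinnedLineToolkit

/-!
# Stub `stub_quasimodeUnionBound` of line `kac-rice-hermitian-dos`
(crux `Summit.QuantumFields.QCD.Theses.NestedDissectionSea.EarlyCrosserLaw`, item stmt-QuantumFields-13995)

The MEASURE step of the line: the crux's phase-quenched ratio functional
`P(E) = ∫ 1_E · wt dμ_W / ∫ wt dμ_W` (weight `wt U = ∏_f ‖det D_W(U, mq_f, 1)‖ ≥ 0`, measurable and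
integrable against the probability Wilson measure of the odd four-torus of side `2S+1`) is
monotone-subadditive over any FINITE family of QUASIMODE EVENTS
`A_i = {U | ∃ w ≠ 0, ‖wilsonCell U μ_i x_i s_i w‖₂² ≤ η_i² ‖w‖₂²}` (the Dirichlet cell has a singular
value `≤ |η_i|`): every event `E` (measurable or not) contained in `⋃_i A_i` has
`P(E) ≤ Σ_i P(A_i)`.

* `QuasimodeUnionBound.ratio_le_sum`: the abstract finite subadditivity with the Bochner
  conventions — `∫ 1_E wt ≤ ∫ (Σ_i 1_{A_i}) wt = Σ_i ∫ 1_{A_i} wt` by `integral_mono_of_nonneg` (no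
  measurability / integrability of `1_E wt` needed) and `integral_finsetSum`, then `Finset.sum_div`;
* `QuasimodeUnionBound.measurableSet_quasimode`: a quasimode event is the first projection of
  `{(U, w) | ‖D_c(U) w‖₂² ≤ η² ‖w‖₂²} ∩ {(U, w) | 0 < ‖w‖}`, a closed set (`continuous_wilsonCell`,
  `Continuous.matrix_mulVec`) cut by one strict inequality of continuous functions, hence σ-compact
  (`isSigmaCompact_inter_lt` of the `CensusDominates` toolkit); its continuous image is σ-compact, so
  Borel measurable in the compact Hausdorff configuration space;
* `stub_quasimodeUnionBound`: the registered signature, assembled from the two items above and the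
  measurability / integrability of the weight (`measurable_norm_det_diracMatrix`,
  `integrable_norm_det_diracMatrix`, `norm_det_diracMatrix`).
-/

noncomputable section

open scoped BigOperators Classical
open Matrix Complex Filter MeasureTheory
open Literature.MathematicalPhysics.QuantumLattice Literature.MathematicalPhysics.QuantumFieldTheory
  Literature.Probability.LatticeModels
open Summit.QuantumFields.QCD.Theses.NestedDissectionSea

namespace Summit.QuantumFields.QCD.Cruxes.EarlyCrosserLaw.KacRiceHermitianDos

namespace QuasimodeUnionBound

open Summit.QuantumFields.QCD.Cruxes.CoerciveSea.ChiralityCollapsesPseudospectrum.CensusDominates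

/-! ## Finite subadditivity of a weighted ratio -/

/-- **Finite ratio subadditivity.** For a non-negative measurable integrable weight `wt`, a finite
family of measurable events `A i` and ANY event `E ⊆ ⋃ i, A i`, the `wt`-weighted ratios satisfy
`P(E) ≤ Σ i, P(A i)` — with the Bochner conventions (`∫` of a non-integrable function is `0`,
`x / 0 = 0`). -/
theorem ratio_le_sum {Ω ι : Type*} [MeasurableSpace Ω] [Fintype ι] (μ : Measure Ω) (wt : Ω → ℝ)
    (hwt0 : ∀ U, 0 ≤ wt U) (hwtm : Measurable wt) (hwti : Integrable wt μ) (E : Ω → Prop)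
    (A : ι → Ω → Prop) (hA : ∀ i, MeasurableSet {U | A i U}) (hEA : ∀ U, E U → ∃ i, A i U) :
    (∫ U, (if E U then (1 : ℝ) else 0) * wt U ∂μ) / (∫ U, wt U ∂μ) ≤
      ∑ i, (∫ U, (if A i U then (1 : ℝ) else 0) * wt U ∂μ) / (∫ U, wt U ∂μ) := by
  have hind0 : ∀ (P : Prop) [Decidable P] (U : Ω), 0 ≤ (if P then (1 : ℝ) else 0) * wt U :=
    fun P _ U => mul_nonneg (by split_ifs <;> norm_num) (hwt0 U)
  have hint : ∀ i, Integrable (fun U => (if A i U then (1 : ℝ) else 0) * wt U) μ := by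
    intro i
    refine hwti.mono'
      ((Measurable.ite (hA i) measurable_const measurable_const).mul hwtm).aestronglyMeasurable
      (Eventually.of_forall fun U => ?_)
    rw [Real.norm_eq_abs, abs_mul, abs_of_nonneg (hwt0 U)]
    split_ifs
    · rw [abs_one, one_mul]
    · rw [abs_zero, zero_mul]
      exact hwt0 U
  rw [← Finset.sum_div]
  refine div_le_div_of_nonneg_right ?_ (integral_nonneg hwt0)
  rw [← integral_finsetSum _ fun i _ => hint i]
  refine integral_mono_of_nonneg (Eventually.of_forall fun U => hind0 _ U)
    (integrable_finsetSum _ fun i _ => hint i) (Eventually.of_forall fun U => ?_)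
  dsimp only
  by_cases hEU : E U
  · obtain ⟨i, hi⟩ := hEA U hEU
    rw [if_pos hEU, one_mul]
    calc wt U = (if A i U then (1 : ℝ) else 0) * wt U := by rw [if_pos hi, one_mul]
      _ ≤ ∑ j, (if A j U then (1 : ℝ) else 0) * wt U :=
        Finset.single_le_sum (f := fun j => (if A j U then (1 : ℝ) else 0) * wt U)
          (fun j _ => hind0 _ U) (Finset.mem_univ i)
  · rw [if_neg hEU, zero_mul]
    exact Finset.sum_nonneg fun j _ => hind0 _ U

/-! ## Measurability of a quasimode event -/

variable {N : ℕ} [NeZero N]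

/-- The quasimode condition `‖D_c(U) w‖₂² ≤ η² ‖w‖₂²` is CLOSED in the pair `(U, w)` (the cell matrix
depends continuously on `U`, `continuous_wilsonCell`). -/
theorem isClosed_quasimodePair (μ : ℝ) (x : TorusSite 4 N) (s : Fin 4 → ℕ) (η : ℝ) :
    IsClosed {q : GaugeConfig 4 N SU3 × ({p // wilsonBox x s p} → ℂ) |
      ∑ p, ‖(wilsonCell q.1 μ x s *ᵥ q.2) p‖ ^ 2 ≤ η ^ 2 * ∑ p, ‖q.2 p‖ ^ 2} := by
  have h2 : ∀ p : {p // wilsonBox x s p},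
      Continuous fun q : GaugeConfig 4 N SU3 × ({p // wilsonBox x s p} → ℂ) => q.2 p :=
    fun p => (continuous_apply p).comp continuous_snd
  have hmv : Continuous fun q : GaugeConfig 4 N SU3 × ({p // wilsonBox x s p} → ℂ) =>
      wilsonCell q.1 μ x s *ᵥ q.2 :=
    ((continuous_wilsonCell μ x s).comp continuous_fst).matrix_mulVec continuous_snd
  have hL : Continuous fun q : GaugeConfig 4 N SU3 × ({p // wilsonBox x s p} → ℂ) =>
      ∑ p, ‖(wilsonCell q.1 μ x s *ᵥ q.2) p‖ ^ 2 :=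
    continuous_finsetSum _ fun p _ => ((continuous_apply p).comp hmv).norm.pow 2
  have hR : Continuous fun q : GaugeConfig 4 N SU3 × ({p // wilsonBox x s p} → ℂ) =>
      ∑ p, ‖q.2 p‖ ^ 2 :=
    continuous_finsetSum _ fun p _ => (h2 p).norm.pow 2
  exact isClosed_le hL (continuous_const.mul hR)

/-- **A quasimode event is Borel measurable**: `{U | ∃ w ≠ 0, ‖D_c(U) w‖₂² ≤ η² ‖w‖₂²}` is the first
projection of a closed set cut by the strict inequality `0 < ‖w‖`, a σ-compact set, so it is
σ-compact, hence measurable in the Hausdorff Borel configuration space. -/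
theorem measurableSet_quasimode (μ : ℝ) (x : TorusSite 4 N) (s : Fin 4 → ℕ) (η : ℝ) :
    MeasurableSet {U : GaugeConfig 4 N SU3 | ∃ w : {p // wilsonBox x s p} → ℂ, w ≠ 0 ∧
      ∑ p, ‖(wilsonCell U μ x s *ᵥ w) p‖ ^ 2 ≤ η ^ 2 * ∑ p, ‖w p‖ ^ 2} := by
  have h : {U : GaugeConfig 4 N SU3 | ∃ w : {p // wilsonBox x s p} → ℂ, w ≠ 0 ∧
      ∑ p, ‖(wilsonCell U μ x s *ᵥ w) p‖ ^ 2 ≤ η ^ 2 * ∑ p, ‖w p‖ ^ 2} =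
      Prod.fst '' ({q : GaugeConfig 4 N SU3 × ({p // wilsonBox x s p} → ℂ) |
        ∑ p, ‖(wilsonCell q.1 μ x s *ᵥ q.2) p‖ ^ 2 ≤ η ^ 2 * ∑ p, ‖q.2 p‖ ^ 2} ∩
        {q | (fun _ => (0 : ℝ)) q < ‖q.2‖}) := by
    ext U
    simp only [Set.mem_setOf_eq, mem_image_fst, Set.mem_inter_iff, norm_pos_iff]
    exact exists_congr fun w => and_comm
  rw [h]
  exact measurableSet_of_isSigmaCompact ((isSigmaCompact_inter_lt
    (isSigmaCompact_univ.of_isClosed_subset (isClosed_quasimodePair μ x s η) (Set.subset_univ _))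
    continuous_const continuous_snd.norm).image continuous_fst)

end QuasimodeUnionBound

/-- **stub 3 — UNION BOUND FOR THE PHASE-QUENCHED FUNCTIONAL OVER QUASIMODE EVENTS** (measure theory
on `wilsonMeasure`): for the crux's ratio functional (weight `∏_f |det D_W(U, mq_f)|`, any `β`, any
odd torus `2S+1`, any `mq`) and any finite family of quasimode events, every event contained in
their union has ratio `≤ Σ_i` ratios.  Quasimode events are measurable
(`QuasimodeUnionBound.measurableSet_quasimode`); the weight is measurable, integrable, `≥ 0`; the
numerator of an ARBITRARY `E` is `≤` the integral of `(Σ_i 1_{A_i}) · wt` by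
`integral_mono_of_nonneg`, which splits as the sum of the numerators
(`QuasimodeUnionBound.ratio_le_sum`). -/
theorem stub_quasimodeUnionBound :
    ∀ (Nf S : ℕ) (β : ℝ) (mq : Fin Nf → ℝ) (ι : Type) [Fintype ι]
      (x : ι → TorusSite 4 (2 * S + 1)) (sd : ι → Fin 4 → ℕ) (μ η : ι → ℝ)
      (E : GaugeConfig 4 (2 * S + 1) SU3 → Prop),
      (∀ U, E U → ∃ i, ∃ w : {p // wilsonBox (x i) (sd i) p} → ℂ, w ≠ 0 ∧
          ∑ p, ‖(wilsonCell U (μ i) (x i) (sd i) *ᵥ w) p‖ ^ 2 ≤ η i ^ 2 * ∑ p, ‖w p‖ ^ 2) →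
      (∫ U, (if E U then (1 : ℝ) else 0) *
          (∏ f, ‖fermionDet (wilsonDirac (fundamentalRep (Fin 3)) U (mq f) 1)‖)
        ∂(wilsonMeasure (fundamentalRep (Fin 3)) β : Measure (GaugeConfig 4 (2 * S + 1) SU3))) /
        (∫ U, (∏ f, ‖fermionDet (wilsonDirac (fundamentalRep (Fin 3)) U (mq f) 1)‖)
          ∂(wilsonMeasure (fundamentalRep (Fin 3)) β : Measure (GaugeConfig 4 (2 * S + 1) SU3))) ≤
      ∑ i, (∫ U, (if (∃ w : {p // wilsonBox (x i) (sd i) p} → ℂ, w ≠ 0 ∧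
            ∑ p, ‖(wilsonCell U (μ i) (x i) (sd i) *ᵥ w) p‖ ^ 2 ≤ η i ^ 2 * ∑ p, ‖w p‖ ^ 2)
            then (1 : ℝ) else 0) *
          (∏ f, ‖fermionDet (wilsonDirac (fundamentalRep (Fin 3)) U (mq f) 1)‖)
        ∂(wilsonMeasure (fundamentalRep (Fin 3)) β : Measure (GaugeConfig 4 (2 * S + 1) SU3))) /
        (∫ U, (∏ f, ‖fermionDet (wilsonDirac (fundamentalRep (Fin 3)) U (mq f) 1)‖)
          ∂(wilsonMeasure (fundamentalRep (Fin 3)) β : Measure (GaugeConfig 4 (2 * S + 1) SU3))) := by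
  intro Nf S β mq ι _ x sd μ η E hE
  have hwt0 : ∀ U : GaugeConfig 4 (2 * S + 1) SU3,
      0 ≤ ∏ f, ‖fermionDet (wilsonDirac (fundamentalRep (Fin 3)) U (mq f) 1)‖ :=
    fun U => Finset.prod_nonneg fun f _ => norm_nonneg _
  have hwtm : Measurable fun U : GaugeConfig 4 (2 * S + 1) SU3 =>
      ∏ f, ‖fermionDet (wilsonDirac (fundamentalRep (Fin 3)) U (mq f) 1)‖ := by
    simpa only [norm_det_diracMatrix] using measurable_norm_det_diracMatrix (S := 2 * S + 1) mq
  have hwti : Integrable (fun U : GaugeConfig 4 (2 * S + 1) SU3 =>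
      ∏ f, ‖fermionDet (wilsonDirac (fundamentalRep (Fin 3)) U (mq f) 1)‖)
      (wilsonMeasure (fundamentalRep (Fin 3)) β : Measure (GaugeConfig 4 (2 * S + 1) SU3)) := by
    simpa only [norm_det_diracMatrix] using integrable_norm_det_diracMatrix (S := 2 * S + 1) mq
      (wilsonMeasure (fundamentalRep (Fin 3)) β : Measure (GaugeConfig 4 (2 * S + 1) SU3))
  exact QuasimodeUnionBound.ratio_le_sum _ _ hwt0 hwtm hwti E
    (fun i U => ∃ w : {p // wilsonBox (x i) (sd i) p} → ℂ, w ≠ 0 ∧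
      ∑ p, ‖(wilsonCell U (μ i) (x i) (sd i) *ᵥ w) p‖ ^ 2 ≤ η i ^ 2 * ∑ p, ‖w p‖ ^ 2)
    (fun i => QuasimodeUnionBound.measurableSet_quasimode (μ i) (x i) (sd i) (η i)) hE

end Summit.QuantumFields.QCD.Cruxes.EarlyCrosserLaw.KacRiceHermitianDos

end
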